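import Literature.MathematicalPhysics.QuantumFieldTheory.Balaban1983to89.B9Thm31SiteGpGradDecayReg335Y

/-!
# `Balaban1983to89.B9Thm31SiteGpDivDecayReg335Y` — T. Bałaban, *Propagators for lattice gauge theories in a background field*, Commun. Math. Phys. **99**
# (1985) 389–434 [Balaban1985BackgroundPropagators] Thm 3.1 (3.46) p. 398 (third inequality) with (3.8) p. 392: ★★★ **THE `L²`-LOCAL DECAY OF
# `G′(U)∇\*_U` ON THE (3.35) CLASS, BY DUALITY** — `Σ_{z∈B} HS((G′(U)∇\*_{U,μ}λ)(z)) ≤ 160·(L^{j_B})²·W⁻²·‖λ‖²₁` for `λ` supported in `A`, the transpose of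
# file 8's (3.46b) through `⟨∇_{U,μ}Φ, λ⟩₁ = ⟨Φ, ∇\*_{U,μ}λ⟩₁` (dag-n06-i) and the `trIP`-symmetry of `G′` (dag-n06-j) (file 9 of the site-coercivity set of
# width seat `pub-ymgap-dag-n06-w1`)

statement-level skeleton of published theorems with citation tags; proofs where landed; nothing here is a claim about the Yang–Mills mass gap

THE PRINT (p. 398, verbatim).  *«‖hG′(U)λ‖, ‖hζ∇_UG′(U)λ‖(Lʲη), ‖hG′(U)∇\*_Uζλ‖(Lʲη), … ≤ B₀(Lʲη)(Lʲ′η)e^{−δ₀d(y,y′)}‖h‖‖λ‖ … (3.46)»*; p. 398: *«the choice of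
powers Lʲη is conventional also. Using Lemma 2.1 in [4] we may replace the factor (Lʲη)^α by (Lʲη)^β(Lʲ′η)^γ with β + γ = α»*; (3.8) p. 392: `D\*` is the
adjoint of `D` for the trace pairing.

WHY THIS FILE ∕ THE ARGUMENT.  The third entry of (3.46) is the TRANSPOSE of the second: for any pair of maps `T, T′` adjoint for the weight-`1` trace pairing
(`⟨TΨ, λ⟩₁ = ⟨Ψ, T′λ⟩₁`) a bound `Σ_{z∈A}HS((TΨ)(z)) ≤ C‖Ψ‖²₁` for all `Ψ` supported in `B` is EQUIVALENT to `Σ_{z∈B}HS((T′λ)(z)) ≤ C‖λ‖²₁` for all `λ`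
supported in `A` (§1, `hs_restrict_dual_le` — Cauchy–Schwarz against the support, no linearity needed).  With `T = ∇_{U,μ} ∘ G′(U)` and `T′ = G′(U) ∘ ∇\*_{U,μ}`
(adjoint by dag-n06-i's `trIP_cdS_left` and dag-n06-j's `isSymmTr_GpY_parSymY`) file 8's (3.46b) transposes to (3.46c) with the SAME constant; the level
factor stays attached to the set where `ω = 1` (print's convention modulo [4] Lemma 2.1, quoted above).

WHAT IS PROVED (sorry-free; 0 `def`; nothing of [B9] asserted beyond what is proved).
* §1 `trIP_indicator_eq_sum` , ★ `hs_restrict_dual_le` (the duality of support-restricted `HS` bounds for a trace-adjoint pair of maps).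
* §2 `trIP_cdS_GpY_adjoint` (`⟨∇_{U,μ}G′Ψ, λ⟩₁ = ⟨Ψ, G′∇\*_{U,μ}λ⟩₁`), ★★★ **`hs_restrict_GpY_cdsS_le`** (abstract weight, hypotheses of file 8:
  `Σ_{z∈B}HS((G′(U)∇\*_{U,μ}λ)(z)) ≤ 160·((L^{j_B})²∕W²)·‖λ‖²₁` for every `λ` vanishing off `A` and every direction `μ`) and ★★★
  **`hs_restrict_GpY_cdsS_le_exp_canonical`** (the weight `e^{δ₀ρ}`, `δ₀ = 1∕(4(d+2))`).
MODEL ∕ DECLARED READINGS.  As files 6–8; `∇\*_{U,μ} = cdsS i U μ` (def-Y's covariant backward difference (3.8)); here the field `λ` lives on `A` (where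
`ω ≥ W`, i.e. far from `B` in the weight) and `G′∇\*λ` is read on `B` (where `ω = 1`); the prefactor `(L^{j_B})²` carries the READING set's level (print attaches
`Lʲ′η` to the source — equivalent modulo Lemma 2.1 of [4], not typed here).  NOT HERE: second-order entries, (3.42)–(3.45), (3.47), the bond sector.
HONEST SCOPE.  A duality bookkeeping step for one finite lattice operator; NOT a node discharge, NOT summit progress; count-neutral; nothing continuum ∕ OS ∕
mass gap ∕ Clay.  NEW file importing file 8 only; nothing landed is modified.  Net new unproved facts: 0.
-/

noncomputable section

namespace Literature.MathematicalPhysics.QuantumFieldTheory.Balaban1983to89.B9Thm31SiteGpDivDecayReg335Y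

open Literature.MathematicalPhysics.QuantumFieldTheory.Balaban1983to89
open Node00 B6KLevelCensusIndexV1 B6Geom246MultiLevelBox B6MultiLevelBoxOperator B6MultiLevelTorusOperator B6GlobalChartV1 B9BackgroundsKLevelV1
  B9Eq39Adjoint B9Thm311ReadingCoords B9Thm311DeltaPrimePos B9Ineq369CurvatureSmallAtLettersY B9Thm31SiteCoerciveGaugeBlockY
  B9Thm31SiteCoerciveReg335Y B9Thm31SiteGpBoundsReg335Y B9Thm31SitePolarisedFormY B9Thm31SiteConjugatedFormY B9Thm31SiteGpDecayReg335Y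
  B9Thm31SiteAgmonWeightY B9Thm31SiteGpGradDecayReg335Y
open Literature.MathematicalPhysics.QuantumFieldTheory.Balaban1983to89.B9Ineq349SiteAdjoint (trIP_comm trIP_cdS_left isSymmTr_GpY_parSymY)
open Literature.MathematicalPhysics.QuantumFieldTheory.Balaban1983to89.B9Thm311DeltaPrimeSymm (trIP_one_eq)
open scoped Matrix Matrix.Norms.L2Operator

/-! ## §1 Duality of support-restricted bounds -/

section Dual

variable {S : Type} [Fintype S] [DecidableEq S] {N : ℕ}

/-- the pairing of the `B`-restriction of `Φ` with `Φ` is the `HS`-sum over `B`. [cite: Balaban1985BackgroundPropagators, p.393 (scalar products), bookkeeping] -/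
theorem trIP_indicator_eq_sum (B : Finset S) (Φ : S → Matrix (Fin N) (Fin N) ℂ) :
    trIP (fun _ => (1 : ℝ)) (fun z => if z ∈ B then Φ z else 0) Φ = ∑ z ∈ B, ∑ a, ∑ b, ‖Φ z a b‖ ^ 2 := by
  rw [trIP_one_eq, Complex.re_sum, ← Finset.sum_filter_add_sum_filter_not Finset.univ (fun z => z ∈ B)]
  have h0 : ∑ z ∈ Finset.univ.filter (fun z => ¬ z ∈ B), (Matrix.trace ((if z ∈ B then Φ z else 0)ᴴ * Φ z)).re = 0 :=
    Finset.sum_eq_zero fun z hz => by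
      have hz' : z ∉ B := (Finset.mem_filter.1 hz).2
      simp [hz']
  rw [h0, add_zero, Finset.filter_mem_eq_inter, Finset.univ_inter]
  refine Finset.sum_congr rfl fun z hz => ?_
  rw [if_pos hz, hs_eq_re_trace]

/-- ★ **DUALITY OF SUPPORT-RESTRICTED BOUNDS**: if `⟨TΨ, λ⟩₁ = ⟨Ψ, T′λ⟩₁` for all `Ψ, λ` and `Σ_{z∈A}HS((TΨ)(z)) ≤ C‖Ψ‖²₁` for every `Ψ` vanishing off `B`,
then `Σ_{z∈B}HS((T′λ)(z)) ≤ C‖λ‖²₁` for every `λ` vanishing off `A` (`‖1_BT′1_A‖ = ‖1_AT1_B‖`). [cite: Balaban1985BackgroundPropagators, (3.8) p.392, Thm 3.1 (3.46) p.398, bookkeeping] -/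
theorem hs_restrict_dual_le {T T' : (S → Matrix (Fin N) (Fin N) ℂ) → (S → Matrix (Fin N) (Fin N) ℂ)}
    (hadj : ∀ Ψ Λ, trIP (fun _ => (1 : ℝ)) (T Ψ) Λ = trIP (fun _ => (1 : ℝ)) Ψ (T' Λ)) {A B : Finset S} {C : ℝ} (hC : 0 ≤ C)
    (hT : ∀ Ψ : S → Matrix (Fin N) (Fin N) ℂ, (∀ z, z ∉ B → Ψ z = 0) → ∑ z ∈ A, ∑ a, ∑ b, ‖T Ψ z a b‖ ^ 2 ≤ C * trIP (fun _ => (1 : ℝ)) Ψ Ψ)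
    (Λ : S → Matrix (Fin N) (Fin N) ℂ) (hΛ : ∀ z, z ∉ A → Λ z = 0) :
    ∑ z ∈ B, ∑ a, ∑ b, ‖T' Λ z a b‖ ^ 2 ≤ C * trIP (fun _ => (1 : ℝ)) Λ Λ := by
  set Φ := T' Λ with hΦ
  set Ψ : S → Matrix (Fin N) (Fin N) ℂ := fun z => if z ∈ B then Φ z else 0 with hΨ
  have hΨB : ∀ z, z ∉ B → Ψ z = 0 := fun z hz => by simp [hΨ, hz]
  set P : ℝ := ∑ z ∈ B, ∑ a, ∑ b, ‖Φ z a b‖ ^ 2 with hP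
  have hP0 : 0 ≤ P := Finset.sum_nonneg fun _ _ => hs_nonneg _
  have hQ0 : 0 ≤ trIP (fun _ => (1 : ℝ)) Λ Λ := trIP_self_nonneg _ (fun _ => one_pos) Λ
  -- `‖Ψ‖² = P`, `⟨Ψ, Φ⟩ = P`
  have hΨΨ : trIP (fun _ => (1 : ℝ)) Ψ Ψ = P := by
    rw [trIP_one_self_eq, hP, ← Finset.sum_filter_add_sum_filter_not Finset.univ (fun z => z ∈ B)]
    have h0 : ∑ z ∈ Finset.univ.filter (fun z => ¬ z ∈ B), ∑ a, ∑ b, ‖Ψ z a b‖ ^ 2 = 0 :=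
      Finset.sum_eq_zero fun z hz => by rw [hΨB z (Finset.mem_filter.1 hz).2]; simp
    rw [h0, add_zero, Finset.filter_mem_eq_inter, Finset.univ_inter]
    refine Finset.sum_congr rfl fun z hz => ?_
    simp only [hΨ, hz, if_true]
  have hΨΦ : trIP (fun _ => (1 : ℝ)) Ψ Φ = P := trIP_indicator_eq_sum B Φ
  -- `P = ⟨Ψ, T′λ⟩ = ⟨TΨ, λ⟩ ≤ √(C P)·‖λ‖`
  have hdual : P = trIP (fun _ => (1 : ℝ)) (T Ψ) Λ := by rw [hadj, ← hΦ, hΨΦ]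
  have hcs := abs_trIP_le_of_support_generic hΛ (T Ψ)
  have hTΨ := hT Ψ hΨB
  rw [hΨΨ] at hTΨ
  have h1 : P ^ 2 ≤ (C * P) * trIP (fun _ => (1 : ℝ)) Λ Λ := by
    calc P ^ 2 = |trIP (fun _ => (1 : ℝ)) (T Ψ) Λ| ^ 2 := by rw [← hdual, sq_abs]
      _ ≤ (Real.sqrt (∑ z ∈ A, ∑ a, ∑ b, ‖T Ψ z a b‖ ^ 2) * Real.sqrt (trIP (fun _ => (1 : ℝ)) Λ Λ)) ^ 2 := pow_le_pow_left₀ (abs_nonneg _) hcs 2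
      _ = (∑ z ∈ A, ∑ a, ∑ b, ‖T Ψ z a b‖ ^ 2) * trIP (fun _ => (1 : ℝ)) Λ Λ := by
          rw [mul_pow, Real.sq_sqrt (Finset.sum_nonneg fun _ _ => hs_nonneg _), Real.sq_sqrt hQ0]
      _ ≤ (C * P) * trIP (fun _ => (1 : ℝ)) Λ Λ := mul_le_mul_of_nonneg_right hTΨ hQ0
  rcases hP0.eq_or_lt with h0 | hpos
  · rw [← h0]; exact mul_nonneg hC hQ0
  · have h2 : P * P ≤ (C * trIP (fun _ => (1 : ℝ)) Λ Λ) * P := by nlinarith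
    exact le_of_mul_le_mul_right h2 hpos
where
  /-- Cauchy–Schwarz against a field supported in `A` (generic carrier). -/
  abs_trIP_le_of_support_generic {A : Finset S} {Λ : S → Matrix (Fin N) (Fin N) ℂ} (hΛ : ∀ z, z ∉ A → Λ z = 0)
      (Φ : S → Matrix (Fin N) (Fin N) ℂ) :
      |trIP (fun _ => (1 : ℝ)) Φ Λ| ≤ Real.sqrt (∑ z ∈ A, ∑ a, ∑ b, ‖Φ z a b‖ ^ 2) * Real.sqrt (trIP (fun _ => (1 : ℝ)) Λ Λ) := by
    set ΦA : S → Matrix (Fin N) (Fin N) ℂ := fun z => if z ∈ A then Φ z else 0 with hΦA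
    have heq : trIP (fun _ => (1 : ℝ)) Φ Λ = trIP (fun _ => (1 : ℝ)) ΦA Λ := by
      rw [trIP_one_eq, trIP_one_eq]
      congr 1
      refine Finset.sum_congr rfl fun z _ => ?_
      by_cases hz : z ∈ A
      · simp only [hΦA, hz, if_true]
      · rw [hΛ z hz, Matrix.mul_zero, Matrix.mul_zero]
    have hA : trIP (fun _ => (1 : ℝ)) ΦA ΦA = ∑ z ∈ A, ∑ a, ∑ b, ‖Φ z a b‖ ^ 2 := by
      rw [trIP_comm, show ΦA = fun z => if z ∈ A then Φ z else 0 from rfl]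
      rw [show (trIP (fun _ => (1 : ℝ)) (fun z => if z ∈ A then Φ z else 0) fun z => if z ∈ A then Φ z else 0)
          = trIP (fun _ => (1 : ℝ)) (fun z => if z ∈ A then Φ z else 0) Φ by
            rw [trIP_one_eq, trIP_one_eq]
            congr 1
            refine Finset.sum_congr rfl fun z _ => ?_
            by_cases hz : z ∈ A
            · simp only [hz, if_true]
            · simp only [hz, if_false, Matrix.conjTranspose_zero, Matrix.zero_mul]]
      exact trIP_indicator_eq_sum A Φ
    rw [heq, ← hA]
    exact abs_trIP_le _ (fun _ => one_pos) ΦA Λ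

end Dual

/-! ## §2 (3.46c): `G′(U)∇*_U` by duality -/

section Main

variable {d ℓ : ℕ} {hd : 1 ≤ d + 1} {hL : Odd (ℓ + 1) ∧ 1 < ℓ + 1} {b₀ b₁ : ℝ}
variable (i : KIdx d ℓ hd hL b₀ b₁) {N : ℕ} {G : Subgroup (Matrix (Fin N) (Fin N) ℂ)ˣ}

/-- `∇_{U,μ}∘G′(U)` and `G′(U)∘∇\*_{U,μ}` ARE ADJOINT for the trace pairing at a `G`-valued background, `G ≤ U(N)`: `⟨∇_{U,μ}G′Ψ, λ⟩₁ = ⟨Ψ, G′∇\*_{U,μ}λ⟩₁`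
(dag-n06-i's `trIP_cdS_left` and `isSymmTr_GpY_parSymY`). [cite: Balaban1985BackgroundPropagators, (3.8) p.392, (3.25) p.394] -/
theorem trIP_cdS_GpY_adjoint (hG : G ≤ B7Prop2Explicit.unitaryUnits (Matrix (Fin N) (Fin N) ℂ)) {U : CfgY (Matrix (Fin N) (Fin N) ℂ) i}
    (hU : ∀ μ x, U μ x ∈ G) (μ : Fin (d + 1)) (Ψ Λ : SiteY i → Matrix (Fin N) (Fin N) ℂ) :
    trIP (fun _ => (1 : ℝ)) (cdS i U μ (GpY i (parSymY i) U Ψ)) Λ = trIP (fun _ => (1 : ℝ)) Ψ (GpY i (parSymY i) U (cdsS i U μ Λ)) := by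
  rw [trIP_cdS_left i (fun μ x => hG (hU μ x)) μ, isSymmTr_GpY_parSymY i hG hU]

/-- ★★★ **THE `L²`-LOCAL DECAY OF `G′(U)∇\*_U` ON THE CLASS (3.35) — (3.46c)'s SHAPE, BY DUALITY FROM FILE 8.**  Hypotheses of file 8's
`hs_restrict_cdS_GpY_parSymY_le` (class; weight `ω` with `ω = 1` on `B`, `ω ≥ W > 0` on `A`, bond ratios, block oscillation, `(d+1)θ_b + θ_s∕2 ≤ 1∕16`,
`0 ≤ θ_b, θ_s`, levels `≤ j_B` on `B`).  THEN for every direction `μ` and every `λ` vanishing off `A`: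
`Σ_{z∈B} HS((G′(U)∇\*_{U,μ}λ)(z)) ≤ 160·((L^{j_B})²∕W²)·‖λ‖²₁`. [cite: Balaban1985BackgroundPropagators, Thm 3.1 (3.46) p.398, (3.8) p.392; Agmon1982, Ch.1, Thm 1.5] -/
theorem hs_restrict_GpY_cdsS_le [Nonempty (Fin N)] (hG : G ≤ B7Prop2Explicit.unitaryUnits (Matrix (Fin N) (Fin N) ℂ))
    {U : CfgY (Matrix (Fin N) (Fin N) ℂ) i} {c α₀ : ℝ} (hC0 : 0 ≤ c * (kGeo i).M * α₀) (hC1 : c * (kGeo i).M * α₀ * ((d : ℝ) + 1) ≤ 1 / 16)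
    (hreg : (bg9K (Matrix (Fin N) (Fin N) ℂ) G i).Reg335 c α₀ U) {ω : SiteY i → ℝ} (hω : ∀ z, 0 < ω z) {θb θs : ℝ} (hθb0 : 0 ≤ θb) (hθs0 : 0 ≤ θs)
    (hb1 : ∀ μ z, ω (shiftY i μ z) / ω z + ω z / ω (shiftY i μ z) - 2 ≤ θb * (((((ℓ + 1) ^ (blkOf i.D.toDomains z).1.1 : ℕ) : ℝ)) ^ 2)⁻¹)
    (hb2 : ∀ μ z, ω (shiftY i μ z) / ω z + ω z / ω (shiftY i μ z) - 2 ≤ θb * (((((ℓ + 1) ^ (blkOf i.D.toDomains (shiftY i μ z)).1.1 : ℕ) : ℝ)) ^ 2)⁻¹)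
    (hs : ∀ z w : SiteY i, blkOf i.D.toDomains w = blkOf i.D.toDomains z → ω z / ω w + ω w / ω z - 2 ≤ θs)
    (hκ : ((d : ℝ) + 1) * θb + θs / 2 ≤ 1 / 16)
    {A B : Finset (SiteY i)} (hωB : ∀ z ∈ B, ω z = 1) {jB : ℕ} (hjB : ∀ z ∈ B, (blkOf i.D.toDomains z).1.1 ≤ jB) {W : ℝ} (hW0 : 0 < W)
    (hW : ∀ z ∈ A, W ≤ ω z) (μ : Fin (d + 1)) (Λ : SiteY i → Matrix (Fin N) (Fin N) ℂ) (hΛ : ∀ z, z ∉ A → Λ z = 0) :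
    ∑ z ∈ B, ∑ a, ∑ b, ‖GpY i (parSymY i) U (cdsS i U μ Λ) z a b‖ ^ 2
      ≤ 160 * (((((ℓ + 1) ^ jB : ℕ) : ℝ)) ^ 2 / W ^ 2) * trIP (fun _ => (1 : ℝ)) Λ Λ := by
  classical
  have hU : ∀ μ x, U μ x ∈ G := hreg.1
  refine hs_restrict_dual_le (T := fun Ψ => cdS i U μ (GpY i (parSymY i) U Ψ)) (T' := fun Λ => GpY i (parSymY i) U (cdsS i U μ Λ))
    (fun Ψ Λ => trIP_cdS_GpY_adjoint i hG hU μ Ψ Λ) (by positivity) (fun Ψ hΨ => ?_) Λ hΛ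
  refine le_trans ?_ (hs_restrict_cdS_GpY_parSymY_le i hG hC0 hC1 hreg hω hθb0 hθs0 hb1 hb2 hs hκ hΨ hωB hjB hW0 hW)
  exact Finset.sum_le_sum fun z _ => Finset.single_le_sum (f := fun ν : Fin (d + 1) => ∑ a, ∑ b, ‖cdS i U ν (GpY i (parSymY i) U Ψ) z a b‖ ^ 2)
    (fun ν _ => hs_nonneg _) (Finset.mem_univ μ)

/-- ★★★ **(3.46c) WITH THE CANONICAL AGMON WEIGHT** `e^{δ₀ρ}`, `δ₀ = 1∕(4(d+2))` (`ρ` bond-Lipschitz at scale `L^{−lev}`, block oscillation `≤ d+1`, `ρ = 0` on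
`B`, `ρ ≥ r` on `A`, levels `≤ j_B` on `B`): `Σ_{z∈B} HS((G′(U)∇\*_{U,μ}λ)(z)) ≤ 160·((L^{j_B})²∕(e^{δ₀r})²)·‖λ‖²₁` for `λ` vanishing off `A`.
[cite: Balaban1985BackgroundPropagators, Thm 3.1 (3.46) p.398; Agmon1982, Ch.1, Thm 1.5] -/
theorem hs_restrict_GpY_cdsS_le_exp_canonical [Nonempty (Fin N)] (hG : G ≤ B7Prop2Explicit.unitaryUnits (Matrix (Fin N) (Fin N) ℂ))
    {U : CfgY (Matrix (Fin N) (Fin N) ℂ) i} {c α₀ : ℝ} (hC0 : 0 ≤ c * (kGeo i).M * α₀) (hC1 : c * (kGeo i).M * α₀ * ((d : ℝ) + 1) ≤ 1 / 16)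
    (hreg : (bg9K (Matrix (Fin N) (Fin N) ℂ) G i).Reg335 c α₀ U) {ρ : SiteY i → ℝ}
    (hρ1 : ∀ μ z, |ρ (shiftY i μ z) - ρ z| ≤ ((((ℓ + 1) ^ (blkOf i.D.toDomains z).1.1 : ℕ) : ℝ))⁻¹)
    (hρ2 : ∀ μ z, |ρ (shiftY i μ z) - ρ z| ≤ ((((ℓ + 1) ^ (blkOf i.D.toDomains (shiftY i μ z)).1.1 : ℕ) : ℝ))⁻¹)
    (hρD : ∀ z w : SiteY i, blkOf i.D.toDomains w = blkOf i.D.toDomains z → |ρ z - ρ w| ≤ (d : ℝ) + 1)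
    {A B : Finset (SiteY i)} (hρB : ∀ z ∈ B, ρ z = 0) {jB : ℕ} (hjB : ∀ z ∈ B, (blkOf i.D.toDomains z).1.1 ≤ jB) {r : ℝ} (hr : ∀ z ∈ A, r ≤ ρ z)
    (μ : Fin (d + 1)) (Λ : SiteY i → Matrix (Fin N) (Fin N) ℂ) (hΛ : ∀ z, z ∉ A → Λ z = 0) :
    ∑ z ∈ B, ∑ a, ∑ b, ‖GpY i (parSymY i) U (cdsS i U μ Λ) z a b‖ ^ 2
      ≤ 160 * (((((ℓ + 1) ^ jB : ℕ) : ℝ)) ^ 2 / Real.exp ((1 / (4 * ((d : ℝ) + 2))) * r) ^ 2) * trIP (fun _ => (1 : ℝ)) Λ Λ := by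
  have hd0 : (0 : ℝ) ≤ d := Nat.cast_nonneg d
  have hd2 : (0 : ℝ) < 4 * ((d : ℝ) + 2) := by positivity
  have hδ0 : (0 : ℝ) ≤ 1 / (4 * ((d : ℝ) + 2)) := by positivity
  have hδ1 : 1 / (4 * ((d : ℝ) + 2)) ≤ 1 := by rw [div_le_one hd2]; linarith
  have hδD : 1 / (4 * ((d : ℝ) + 2)) * ((d : ℝ) + 1) ≤ 1 := by
    rw [div_mul_eq_mul_div, one_mul, div_le_one hd2]; linarith
  have hδκ0 : (1 / (4 * ((d : ℝ) + 2))) ^ 2 * (2 * ((d : ℝ) + 1) + ((d : ℝ) + 1) ^ 2) ≤ 1 / 16 := by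
    rw [div_pow, one_pow, mul_pow, one_div_mul_eq_div, div_le_iff₀ (by positivity)]
    nlinarith
  have hδκ : ((d : ℝ) + 1) * (2 * (1 / (4 * ((d : ℝ) + 2))) ^ 2) + (2 * (1 / (4 * ((d : ℝ) + 2))) ^ 2 * ((d : ℝ) + 1) ^ 2) / 2 ≤ 1 / 16 := by
    have e : ((d : ℝ) + 1) * (2 * (1 / (4 * ((d : ℝ) + 2))) ^ 2) + (2 * (1 / (4 * ((d : ℝ) + 2))) ^ 2 * ((d : ℝ) + 1) ^ 2) / 2
        = (1 / (4 * ((d : ℝ) + 2))) ^ 2 * (2 * ((d : ℝ) + 1) + ((d : ℝ) + 1) ^ 2) := by ring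
    rw [e]; exact hδκ0
  have hω : ∀ z, 0 < Real.exp (1 / (4 * ((d : ℝ) + 2)) * ρ z) := fun z => Real.exp_pos _
  have hωB : ∀ z ∈ B, Real.exp (1 / (4 * ((d : ℝ) + 2)) * ρ z) = 1 := fun z hz => by rw [hρB z hz, mul_zero, Real.exp_zero]
  have hW : ∀ z ∈ A, Real.exp (1 / (4 * ((d : ℝ) + 2)) * r) ≤ Real.exp (1 / (4 * ((d : ℝ) + 2)) * ρ z) :=
    fun z hz => Real.exp_le_exp.2 (mul_le_mul_of_nonneg_left (hr z hz) hδ0)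
  exact hs_restrict_GpY_cdsS_le i hG hC0 hC1 hreg hω (by positivity) (by positivity)
    (fun μ z => bondRatio_exp_le i hδ0 hδ1 μ z (hρ1 μ z)) (fun μ z => bondRatio_exp_le' i hδ0 hδ1 μ z (hρ2 μ z))
    (fun z w hzw => blockOsc_exp_le i hδ0 hδD z w (hρD z w hzw)) hδκ hωB hjB (Real.exp_pos _) hW μ Λ hΛ

end Main

end Literature.MathematicalPhysics.QuantumFieldTheory.Balaban1983to89.B9Thm31SiteGpDivDecayReg335Y
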